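import Literature.NumberTheory.DiophantineGeometry.HeightIntegerForms
import Literature.IUT.LogVolume.Corollary22Statement
import HarnessLib

/-!
# [IUTchIV] Corollary 2.2 (i): `(1/6)·ht_∞ ≈ ht_{ω_X(D)}` — the height of `j(λ)` is `6·h(λ) + O([F:ℚ])`, PROVED

Mochizuki, *Inter-universal Teichmüller theory IV*, RIMS manuscript (Apr. 2020; = PRIMS **57** (2021)),
Cor. 2.2 (i), p. 41, third equivalence; printed proof (p. 43): "since [as is well-known] the pull-back to `X`
of the divisor at infinity of the natural compactification `(M̄_ell)_ℚ` … is of degree `6`, while the line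
bundle `ω_X(D)` is of degree `1`, the equality of BD-classes `(1/6)·ht_∞ ≈ ht_{ω_X(D)}` on `K_V ⊆ U_X(ℚ̄)` follows
immediately from [GenEll], Proposition 1.4, (i), (iii)" — i.e. functoriality of heights under the degree-6
map `j : X = ℙ¹_λ → ℙ¹_j` (Hindry–Silverman, *Diophantine Geometry*, Thm. B.2.5: `h(φ(P)) = deg φ · h(P) + O(1)`).
Classical and undisputed; nothing about Θ-data here.

With the representatives of `Corollary22Statement.lean` (`htInfty P = (1/[F:ℚ])·h_F(j(λ))`,
`NFPoint.ht P = (1/[F:ℚ])·h_F(λ)`), we PROVE `|h_F(j(λ)) − 6·h_F(λ)| ≤ [F:ℚ]·C` with an explicit absolute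
constant `C` (`logHeight_jInv_sub_le`), uniformly over all number fields `F` and all `λ ∈ F ∖ {0,1}`, hence the
BD-equivalence `(1/6)·htInfty ≈ ht` on every set of points of `U_X` (`partI_third`). Method: Mathlib's
`Height.logHeight_eval_le` / `logHeight_eval_ge` for the binary forms `p = ((X₀²−X₀X₁+X₁²)³, X₀²X₁²(X₀−X₁)²)`
(degree 6, so that `[p₀ : p₁](λ : 1) = [j(λ)/256 : 1]`) with the degree-5 Nullstellensatz certificates
`X₀^11 = (X₀⁵+3X₀⁴X₁−3X₀³X₁²)·p₀ + (6X₀⁵−8X₀⁴X₁+11X₀³X₁²−6X₀²X₁³+3X₀X₁⁴)·p₁`,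
`X₁^11 = (X₁⁵+3X₀X₁⁴−3X₀²X₁³)·p₀ + (6X₁⁵−8X₀X₁⁴+11X₀²X₁³−6X₀³X₁²+3X₀⁴X₁)·p₁`,
the uniform constant bounds of `Literature/NumberTheory/DiophantineGeometry/HeightIntegerForms.lean` (integer coefficients ⇒ constants `≤ C^{[F:ℚ]}`), and
the linear change `[256a : b] ↔ [a : b]` (`Height.logHeight_linearMap_apply_le`).
[cite: HindrySilverman2000, Thm B.2.5]
-/

noncomputable section

namespace Literature.IUT.LogVolume

namespace Cor22

open MvPolynomial Height AdmissibleAbsValues Finset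
open Literature.NumberTheory.DiophantineGeometry.IntegerForms
open Literature.NumberTheory.DiophantineGeometry.GenEll

/-! ## The binary forms and the certificates -/

/-- Coefficients of `p₀ = (X₀² − X₀X₁ + X₁²)³` (index = power of `X₀`). [folklore] -/
def cNum : ℕ → ℤ
  | 0 => 1 | 1 => -3 | 2 => 6 | 3 => -7 | 4 => 6 | 5 => -3 | 6 => 1 | _ => 0

/-- Coefficients of `p₁ = X₀²X₁²(X₀ − X₁)² = X₀⁴X₁² − 2X₀³X₁³ + X₀²X₁⁴`. [folklore] -/
def cDen : ℕ → ℤ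
  | 2 => 1 | 3 => -2 | 4 => 1 | _ => 0

/-- Certificate coefficients `q_{(0,0)}` (for `X₀^11`, multiplying `p₀`). [folklore] -/
def cQ00 : ℕ → ℤ
  | 3 => -3 | 4 => 3 | 5 => 1 | _ => 0

/-- Certificate coefficients `q_{(0,1)}` (for `X₀^11`, multiplying `p₁`). [folklore] -/
def cQ01 : ℕ → ℤ
  | 1 => 3 | 2 => -6 | 3 => 11 | 4 => -8 | 5 => 6 | _ => 0

/-- Certificate coefficients `q_{(1,0)}` (for `X₁^11`, multiplying `p₀`). [folklore] -/
def cQ10 : ℕ → ℤ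
  | 0 => 1 | 1 => 3 | 2 => -3 | _ => 0

/-- Certificate coefficients `q_{(1,1)}` (for `X₁^11`, multiplying `p₁`). [folklore] -/
def cQ11 : ℕ → ℤ
  | 0 => 6 | 1 => -8 | 2 => 11 | 3 => -6 | 4 => 3 | _ => 0

variable {K : Type*} [Field K]

/-- The family `p = (p₀, p₁)` of binary sextics with `[p₀ : p₁](λ : 1) = [(λ²−λ+1)³ : λ²(λ−1)²]`. [folklore] -/
def pJ : Fin 2 → MvPolynomial (Fin 2) K :=
  ![ofIntCoeffs (Finset.range 7) (expo 6) cNum, ofIntCoeffs (Finset.range 7) (expo 6) cDen]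

/-- The certificate coefficient lists, indexed by `Fin 2 × Fin 2`. [folklore] -/
def cQ (a : Fin 2 × Fin 2) : ℕ → ℤ :=
  if a = (0, 0) then cQ00 else if a = (0, 1) then cQ01 else if a = (1, 0) then cQ10 else cQ11

/-- The certificate family `q` of binary quintics. [folklore] -/
def qJ (a : Fin 2 × Fin 2) : MvPolynomial (Fin 2) K := ofIntCoeffs (Finset.range 6) (expo 5) (cQ a)

/-- `deg (expo N i) = N` for `i ≤ N`. [folklore] -/
private theorem degree_expo {N i : ℕ} (hi : i ∈ Finset.range (N + 1)) : (expo N i).degree = N := by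
  rw [Finset.mem_range] at hi
  unfold expo
  rw [map_add, Finsupp.degree_single, Finsupp.degree_single]
  omega

/-- Evaluation of an `ofIntCoeffs … (expo N) c` form at `(t, 1)`: `Σ_i c_i t^i`. [folklore] -/
private theorem eval_ofIntCoeffs_at (S : Finset ℕ) (N : ℕ) (c : ℕ → ℤ) (t : K) :
    eval ![t, 1] (ofIntCoeffs (K := K) S (expo N) c) = ∑ i ∈ S, ((c i : ℤ) : K) * t ^ i := by
  unfold ofIntCoeffs
  rw [map_sum]
  refine Finset.sum_congr rfl fun i _ => ?_
  rw [eval_monomial, Finsupp.prod_fintype _ _ (fun j => by simp)]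
  simp [expo, Fin.prod_univ_two, Finsupp.single_apply]

/-- `p₀(λ, 1) = (λ² − λ + 1)³`. [folklore] -/
private theorem eval_pJ_zero (t : K) : eval ![t, 1] ((pJ (K := K)) 0) = (t ^ 2 - t + 1) ^ 3 := by
  simp only [pJ, Matrix.cons_val_zero]
  rw [eval_ofIntCoeffs_at]
  simp [Finset.sum_range_succ, cNum]
  ring

/-- `p₁(λ, 1) = λ²(λ − 1)²`. [folklore] -/
private theorem eval_pJ_one (t : K) : eval ![t, 1] ((pJ (K := K)) 1) = t ^ 2 * (t - 1) ^ 2 := by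
  simp only [pJ, Matrix.cons_val_one, Matrix.cons_val_zero]
  rw [eval_ofIntCoeffs_at]
  simp [Finset.sum_range_succ, cDen]
  ring

/-- The `p_j` are sextic forms with integer coefficients of size `≤ 27`. [folklore] -/
private theorem intCoeffBound_pJ : IntCoeffBound (pJ (K := K)) 6 27 := by
  refine ⟨fun j => ?_, fun j s => ?_⟩
  · fin_cases j <;> exact isHomogeneous_ofIntCoeffs _ _ _ (fun i hi => degree_expo hi)
  · fin_cases j
    · exact coeff_ofIntCoeffs_bound (Finset.range 7) (expo 6) cNum s (by decide)
    · exact coeff_ofIntCoeffs_bound (Finset.range 7) (expo 6) cDen s (by decide)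

/-- The `q_a` are quintic forms with integer coefficients of size `≤ 34`. [folklore] -/
private theorem intCoeffBound_qJ : IntCoeffBound (qJ (K := K)) 5 34 := by
  refine ⟨fun a => isHomogeneous_ofIntCoeffs _ _ _ (fun i hi => degree_expo hi), fun a s => ?_⟩
  refine coeff_ofIntCoeffs_bound _ _ _ _ ?_
  unfold cQ
  split_ifs <;> decide

/-- The Nullstellensatz certificates at `x = (λ, 1)`: `Σ_j q_{(k,j)}(x)·p_j(x) = x_k^{11}`. [folklore] -/
private theorem certificate (t : K) (k : Fin 2) :
    ∑ j, (qJ (K := K) (k, j)).eval ![t, 1] * (pJ j).eval ![t, 1] = (![t, 1] k) ^ (5 + 6) := by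
  rw [Fin.sum_univ_two, eval_pJ_zero, eval_pJ_one]
  fin_cases k
  · simp only [qJ, cQ, eval_ofIntCoeffs_at]
    simp [Finset.sum_range_succ, cQ00, cQ01]
    ring
  · simp only [qJ, cQ, eval_ofIntCoeffs_at]
    simp [Finset.sum_range_succ, cQ10, cQ11]
    ring

/-! ## The height of `[p₀(λ) : p₁(λ)]` versus `6·h(λ)` -/

variable [AdmissibleAbsValues K]

omit [AdmissibleAbsValues K] in
/-- The vector of values `(p₀(λ,1), p₁(λ,1))`. [folklore] -/
private theorem eval_vec (t : K) :
    (fun j => (pJ (K := K) j).eval ![t, 1]) = ![(t ^ 2 - t + 1) ^ 3, t ^ 2 * (t - 1) ^ 2] := by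
  funext j; fin_cases j
  · exact eval_pJ_zero t
  · exact eval_pJ_one t

/-- Two-sided bound: `|h([p₀(λ):p₁(λ)]) − 6·h([λ:1])| ≤ totalWeight·(log 189 + log 204 + log 2)`. [folklore] -/
private theorem abs_logHeight_pJ_sub_le (t : K) :
    |logHeight ![(t ^ 2 - t + 1) ^ 3, t ^ 2 * (t - 1) ^ 2] - 6 * logHeight ![t, 1]| ≤
      totalWeight K * (Real.log 189 + Real.log 204 + Real.log 2) := by
  have hU := logHeight_eval_le (intCoeffBound_pJ (K := K)).homog ![t, 1]
  have hL := logHeight_eval_ge (intCoeffBound_qJ (K := K)).homog (pJ (K := K)) (x := ![t, 1])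
    (fun k => certificate t k)
  rw [eval_vec] at hU hL
  have hBp := log_mulHeightBound_le_of_intCoeff (intCoeffBound_pJ (K := K)) (by norm_num)
  have hBq := log_mulHeightBound_le_of_intCoeff (intCoeffBound_qJ (K := K)) (by norm_num)
  have e189 : ((6 : ℕ) : ℝ) + 1 = 7 := by norm_num
  have e204 : ((5 : ℕ) : ℝ) + 1 = 6 := by norm_num
  rw [e189] at hBp; rw [e204] at hBq
  have h189 : Real.log ((7 : ℝ) * (27 : ℕ)) = Real.log 189 := by norm_num
  have h204 : Real.log ((6 : ℝ) * (34 : ℕ)) = Real.log 204 := by norm_num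
  rw [h189] at hBp; rw [h204] at hBq
  -- the lower-bound constant: `log (2^w · max(MHB q, 1)) = w·log 2 + log max`
  have hcard : (Nat.card (Fin 2) : ℝ) = 2 := by simp
  have hmaxq : 0 < max (mulHeightBound (qJ (K := K))) 1 := lt_of_lt_of_le one_pos (le_max_right _ _)
  have hsplit : Real.log ((Nat.card (Fin 2) : ℝ) ^ totalWeight K * max (mulHeightBound (qJ (K := K))) 1) =
      totalWeight K * Real.log 2 + Real.log (max (mulHeightBound (qJ (K := K))) 1) := by
    rw [hcard, Real.log_mul (by positivity) hmaxq.ne', Real.log_pow]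
  rw [hsplit] at hL
  have hw : (0 : ℝ) ≤ totalWeight K := Nat.cast_nonneg _
  have hl2 : 0 ≤ Real.log 2 := Real.log_nonneg (by norm_num)
  have hl189 : 0 ≤ Real.log 189 := Real.log_nonneg (by norm_num)
  have hl204 : 0 ≤ Real.log 204 := Real.log_nonneg (by norm_num)
  rw [abs_le]
  push_cast at hU hL ⊢
  constructor <;> nlinarith

/-! ## The twist `[256a : b] ↔ [a : b]` (characteristic zero) -/

variable [CharZero K]

/-- The diagonal matrix entries `(m, 0; 0, 1)` as naturals. [folklore] -/
private def diagNat (m : ℕ) (swap : Bool) (a : Fin 2 × Fin 2) : ℕ :=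
  if a = (0, 0) then (if swap then 1 else m) else if a = (1, 1) then (if swap then m else 1) else 0

omit [CharZero K] in
/-- `logHeight (diag) ≤ totalWeight · log m` for `m ≥ 1`. [folklore] -/
private theorem logHeight_diag_le {m : ℕ} (hm : 1 ≤ m) (swap : Bool) :
    logHeight (fun a : Fin 2 × Fin 2 => ((diagNat m swap a : ℕ) : K)) ≤ totalWeight K * Real.log m := by
  cases swap
  · exact logHeight_natTuple_le (diagNat m false) (i₀ := (1, 1)) (by simp [diagNat]) (fun a => by
      unfold diagNat; split_ifs <;> omega)
  · exact logHeight_natTuple_le (diagNat m true) (i₀ := (0, 0)) (by simp [diagNat]) (fun a => by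
      unfold diagNat; split_ifs <;> omega)

/-- `h([m·a : b]) ≤ h([a : b]) + totalWeight·(log 2 + log m)` and `h([a : m·b]) ≤ …`. [folklore] -/
private theorem logHeight_scale_le {m : ℕ} (hm : 1 ≤ m) (a b : K) :
    logHeight ![(m : K) * a, b] ≤ logHeight ![a, b] + totalWeight K * (Real.log 2 + Real.log m) ∧
    logHeight ![a, (m : K) * b] ≤ logHeight ![a, b] + totalWeight K * (Real.log 2 + Real.log m) := by
  have hcard : (Nat.card (Fin 2) : ℝ) = 2 := by simp
  constructor
  · have h := logHeight_linearMap_apply_le (fun p : Fin 2 × Fin 2 => ((diagNat m false p : ℕ) : K)) ![a, b]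
    have e : (fun j => ∑ i, ((diagNat m false (j, i) : ℕ) : K) * ![a, b] i) = ![(m : K) * a, b] := by
      funext j; fin_cases j <;> simp [diagNat]
    rw [e, hcard] at h
    have := logHeight_diag_le (K := K) hm false
    linarith
  · have h := logHeight_linearMap_apply_le (fun p : Fin 2 × Fin 2 => ((diagNat m true p : ℕ) : K)) ![a, b]
    have e : (fun j => ∑ i, ((diagNat m true (j, i) : ℕ) : K) * ![a, b] i) = ![a, (m : K) * b] := by
      funext j; fin_cases j <;> simp [diagNat]
    rw [e, hcard] at h
    have := logHeight_diag_le (K := K) hm true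
    linarith

/-- `|h([256a : b]) − h([a : b])| ≤ totalWeight·(log 2 + log 256)` (`h([a:b]) = h([256a:256b])`). [folklore] -/
private theorem abs_logHeight_twist_le (a b : K) :
    |logHeight ![(256 : K) * a, b] - logHeight ![a, b]| ≤ totalWeight K * (Real.log 2 + Real.log 256) := by
  have h1 := (logHeight_scale_le (K := K) (m := 256) (by norm_num) a b).1
  have h2 := (logHeight_scale_le (K := K) (m := 256) (by norm_num) ((256 : K) * a) b).2
  -- `![256a, 256b] = 256 • ![a, b]` has the same height as `![a, b]`
  have hsm : logHeight ![(256 : K) * a, (256 : K) * b] = logHeight ![a, b] := by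
    have e : ![(256 : K) * a, (256 : K) * b] = (256 : K) • ![a, b] := by
      funext j; fin_cases j <;> simp
    rw [e, logHeight_smul_eq_logHeight _ (by norm_num)]
  push_cast at h1 h2
  rw [hsm] at h2
  rw [abs_le]; constructor <;> linarith

/-! ## The comparison for `j(λ)` and the BD-equivalence -/

/-- **`h(j(λ)) = 6·h(λ) + O([K:ℚ]-weight)`**: for `λ ∈ K ∖ {0, 1}`,
`|h_K(j(λ)) − 6·h_K(λ)| ≤ totalWeight K · (log 189 + log 204 + 2·log 2 + log 256)`.
[cite: HindrySilverman2000, Thm B.2.5] -/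
theorem logHeight₁_jInv_sub_le {t : K} (h0 : t ≠ 0) (h1 : t ≠ 1) :
    |logHeight₁ (jInv t) - 6 * logHeight₁ t| ≤
      totalWeight K * (Real.log 189 + Real.log 204 + 2 * Real.log 2 + Real.log 256) := by
  have hden : t ^ 2 * (t - 1) ^ 2 ≠ 0 := mul_ne_zero (pow_ne_zero _ h0) (pow_ne_zero _ (sub_ne_zero.mpr h1))
  -- `[j(λ) : 1] = (λ²(λ−1)²)⁻¹ • [256·(λ²−λ+1)³ : λ²(λ−1)²]`
  have hj : logHeight₁ (jInv t) = logHeight ![(256 : K) * (t ^ 2 - t + 1) ^ 3, t ^ 2 * (t - 1) ^ 2] := by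
    rw [logHeight₁_eq_logHeight]
    have e : (t ^ 2 * (t - 1) ^ 2) • ![jInv t, 1] = ![(256 : K) * (t ^ 2 - t + 1) ^ 3, t ^ 2 * (t - 1) ^ 2] := by
      have h2 : t ^ 2 ≠ 0 := pow_ne_zero _ h0
      have h3 : (t - 1) ^ 2 ≠ 0 := pow_ne_zero _ (sub_ne_zero.mpr h1)
      funext j; fin_cases j
      · simp [jInv]
        field_simp
        ring
      · simp
    rw [← e, logHeight_smul_eq_logHeight _ hden]
  have hx : logHeight₁ t = logHeight ![t, 1] := logHeight₁_eq_logHeight t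
  rw [hj, hx]
  have hA := abs_logHeight_pJ_sub_le (K := K) t
  have hB := abs_logHeight_twist_le (K := K) ((t ^ 2 - t + 1) ^ 3) (t ^ 2 * (t - 1) ^ 2)
  rw [abs_le] at hA hB ⊢
  constructor <;> nlinarith [hA.1, hA.2, hB.1, hB.2]

/-- The absolute constant of the comparison. [folklore] -/
def jHeightConst : ℝ := Real.log 189 + Real.log 204 + 2 * Real.log 2 + Real.log 256

/-- **[IUTchIV] Cor. 2.2 (i), third equivalence, PROVED**: `(1/6)·ht_∞ ≈ ht_{ω_X(D)}` — with the
representatives `htInfty`, `NFPoint.ht` of the tree, `|(1/6)·htInfty P − ht P| ≤ C/6` for EVERY point `P` of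
`U_X` (any number field of definition), hence the BD-equivalence on every subset of `U_X(ℚ̄)`, in particular on
`K_V`. [cite: HindrySilverman2000, Thm B.2.5] -/
theorem abs_htInfty_sub_ht_le (P : NFPoint) (hP : P.InU) :
    |1 / 6 * htInfty P - P.ht| ≤ jHeightConst / 6 := by
  have hd : (0 : ℝ) < P.degree := by exact_mod_cast P.degree_pos
  have hw : (totalWeight P.F : ℝ) = P.degree := by
    rw [NumberField.totalWeight_eq_finrank]; rfl
  have h := logHeight₁_jInv_sub_le (K := P.F) hP.1 hP.2
  rw [hw] at h
  unfold htInfty NFPoint.ht jHeightConst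
  have h6d : (0 : ℝ) < 6 * P.degree := by linarith
  have e : 1 / 6 * ((P.degree : ℝ)⁻¹ * logHeight₁ (jInv P.x)) - (P.degree : ℝ)⁻¹ * logHeight₁ P.x =
      (logHeight₁ (jInv P.x) - 6 * logHeight₁ P.x) * (6 * (P.degree : ℝ))⁻¹ := by
    ring
  rw [e, abs_mul, abs_of_pos (inv_pos.mpr h6d), mul_inv_le_iff₀ h6d]
  have : (Real.log 189 + Real.log 204 + 2 * Real.log 2 + Real.log 256) / 6 * (6 * (P.degree : ℝ)) =
      (P.degree : ℝ) * (Real.log 189 + Real.log 204 + 2 * Real.log 2 + Real.log 256) := by ring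
  rw [this]
  exact h

/-- **Cor. 2.2 (i), third equivalence as a BD-equivalence on `K_V`**: `(1/6)·ht_∞ ≈ ht_{ω_X(D)}` on `D.toSet`
for every compactly bounded `K_V` (indeed on all of `U_X(ℚ̄)`). [claim: Mochizuki2012, status: disputed] -/
theorem partI_third (D : CBData) : BDEquiv D.toSet (fun P => 1 / 6 * htInfty P) NFPoint.ht := by
  rw [bdEquiv_iff_abs]
  exact ⟨jHeightConst / 6, fun P hP => abs_htInfty_sub_ht_le P (CBData.inU_of_mem hP)⟩

end Cor22

end Literature.IUT.LogVolume

end
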